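import Summits.BirchSwinnertonDyer.BirchSwinnertonDyer.Theorems.ByReductionTypeAtTwoSupersingularColemanRoadV5
import Summits.BirchSwinnertonDyer.Rank1Residual.X5.TwoAdicInstancesToolkitD
import Summits.BirchSwinnertonDyer.Rank1Residual.X5.TwoAdicImageCertificates
import Summits.BirchSwinnertonDyer.Rank1Residual.Supersingular.FrobeniusTraceTwoParity
import Literature.NumberTheory.EllipticCurves.ComplexMultiplicationRationalJIntegralProofs
import Literature.NumberTheory.EllipticCurves.IsogenyHasCMIffJMemProofs
import HarnessLib

/-!
# Route `ByReductionTypeAtTwo` (rung K4), crux `SupersingularRankZeroAtTwo` (item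
# stmt-BirchSwinnertonDyer-19097): the `a₂ = 0` CLASS-INSTANCE KIT on the Coleman road v5 — one
# theorem per class file (seat `bsd-2adic-ss-1`, GEN 8)

HONEST FRAMING (cell `bsd-2adic`, run/shared/lean/pub/bsd-2adic/, HUMAN RULINGS D-0036/D-0054/D-0074):
THEOREMS ONLY; every research input an explicit hypothesis; no definition, no named fact, no instance,
no `sorry`; nothing booked; BSD is NOT proved by any of this. PARTITION (D-0054): X5@2 good-supersingular,
`a₂ = 0` sub-row (B1·O1; 208 rank-`0` classes = 206 with `ρ_{E,2^∞}` onto + 2 without) × `p = 2` —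
types-the-object-of (the class-instance shape of item 19097 on that sub-row); closes none. Companion of
`…ColemanRoadV5.lean` (p489474: the v5 package, stub (4) of line `signed_halves_two` at print scope) and
`…ColemanInstance16173a.lean` (p484590: the first class instance, on the v4 door).

## What a class file has to decide, and what it keeps as hypotheses

For Cremona's reduced minimal model `M = [0, a₂, 1, a₄, a₆]` of the first member of an `a₂ = 0` class
(every such model has `a₁ = 0`, `a₃ = 1`: `ỹ² + ỹ = …` is the supersingular normal form over `𝔽₂`),
KERNEL-DECIDED per class: `Δ`, `c₄`, `b₂, b₄, b₆` (`decide`); global minimality (Silverman VII.1 Rem. 1.1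
at the primes of `gcd(Δ, c₄)`); `2 ∤ Δ` (good reduction); `#M̃(𝔽₂) = 3`, i.e. `a₂(E) = 0`
(`natCard_point_F2_of_a₁_eq_zero_of_a₃_eq_one`); no CM (`Δ ∤ c₄³`, i.e. `j ∉ ℤ`; or `j ∉` the thirteen
CM values); the `2`-adic image `TwoAdicSurjective` from four Dokchitser–Dokchitser certificates
(`twoAdicSurjective_of_certificates`, modulo the PRINT fact `DokchitserDokchitser2012_surjective_mod_two_four_eight`).
HYPOTHESES displayed by every instance: PRINT {modularity `hmod`, GZK `hGZK`, Kato Thm. 12.4 (2)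
`h124`, Kato Thm. 12.4 (1) ∘ (17.13.1) `hX0`, Dokchitser–Dokchitser `hDD`} (accepted named facts);
READ-AT-2 {Kobayashi Thm. 1.2@2 `h12`, Kim Cor. 3.15@2 `hKim` (= the line's stub (2) at the curve), the
v5 Coleman–Kato package at the curve `hCK` (F1 (7.21)@2 [memo] · F3a · F3b `2^m` · F4rat [print at 2] ·
the guarded clause [Kurihara–Otsuki p. 564])}; CERTIFICATES {`L(E,1) ≠ 0`, `#Ш_an = q`, `2^m ∣ #Ш` with
`v₂(q) ≤ m`} (Cremona / eng-2 CERT-CT2-X5ALL «`Ш[2] ⊂ 2Ш[4]`», CERT-L3-CT42 «`Ш[4] ⊂ 2Ш[8]`», two-engine).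

* §1 `bsdp_two_of_colemanKatoV5_of_pow_dvd` — the v5 door per curve (`TwoAdicSurjective W` displayed and
  consumed by the guarded clause): p450683's `bsdp_two_of_upper_of_pow_dvd` with `hup` discharged by
  `signedUpperDivisibility_two_of_colemanKatoV5`. Output `BSD(E, 2) ∧ KobayashiMainConjecture W 2 1`.
* §2 integer-model bookkeeping: `goodSS_two_baseChange_int_of_card_three` (`2 ∤ Δ`, `#M̃(𝔽₂) = 3` ⇒ good
  reduction at `2`, `a₂ = 0`, `GoodSS`), `not_hasCM_baseChange_int_of_not_dvd` (`Δ ∤ c₄³` ⇒ no CM),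
  `not_hasCM_of_j_eq_of_not_mem` (`j ∉ cmJInvariants` ⇒ no CM),
  `twoAdicSurjective_baseChange_int_of_certificates` (the DD certificates on integer data).
* §3 `bsdp_two_baseChange_int_of_colemanKatoV5` — THE ONE-LINE TARGET of a class file: all of the above
  composed; a class file = this theorem applied to literals + `decide`s (generator HOME/ss/classes/gen.py).

References: [Kobayashi2003] Thm. 1.2, 4.1, §7; [Kato2004Asterisque] Thm. 12.4–12.6; [BDKim2013]
Cor. 3.15; [KuriharaOtsuki2006] p. 564; [DokchitserDokchitserMathZ2012] Theorem; [SilvermanAEC2009]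
VII.1 Rem. 1.1, VII.5 Prop. 5.1, App. C §11; [CremonaAlgorithms1997] Table 1; [Miller2011LMS] Def. 1.1.
-/

set_option autoImplicit false
-- the Theorems namespace of this sub repeats the summit name by design (D-0017 nested layout)
set_option linter.dupNamespace false

noncomputable section

open scoped Classical MatrixGroups ModularForm
open CongruenceSubgroup WeierstrassCurve Literature.NumberTheory.EllipticCurves
  Literature.NumberTheory.EllipticCurves.ModularForms Literature.NumberTheory.EllipticCurves.Sprung2017
  Literature.NumberTheory.EllipticCurves.Rank1Residual Literature.NumberTheory.EllipticCurves.Rank1Residual.Typed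
  Literature.NumberTheory.EllipticCurves.Kobayashi2003 Literature.NumberTheory.EllipticCurves.IwasawaDual
  ZpExtension Summit.BirchSwinnertonDyer.Rank1Residual Summit.BirchSwinnertonDyer.Rank1Residual.Supersingular
  Summit.BirchSwinnertonDyer.Rank1Residual.X5 Summit.BirchSwinnertonDyer.Rank1Residual.X5.O1
  Summit.BirchSwinnertonDyer.Rank1Residual.X5.Instances

namespace Summit.BirchSwinnertonDyer.BirchSwinnertonDyer.Theorems
namespace SSColemanRoad

/-! ## §1 The v5 door per curve -/

section Door

variable (W : WeierstrassCurve ℚ) [W.IsElliptic] [W.IsGloballyMinimal]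

/-- **THE `a₂ = 0` DOOR ON THE COLEMAN ROAD v5 (per curve; certificate-fed; `2`-adically surjective).**
PRINT {`hmod`, `hGZK`, `h124`, `hX0`} + `hsurj : TwoAdicSurjective W` + READ-AT-2 {`h12`, `hKim`, the
v5 package `hCK` at `W`} + CERT {`hL`, `hq`, `hv`, `hdvd`} ⇒ `BSD(E, 2) ∧ KobayashiMainConjecture W 2 1`
— p450683's `bsdp_two_of_upper_of_pow_dvd` with the binder `hup` discharged by
`signedUpperDivisibility_two_of_colemanKatoV5`. [cite: Kobayashi2003, Thm. 1.2, Thm. 4.1 and §7]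
[cite: Kato2004Asterisque, Thm. 12.4–12.6 (pp. 221–222)] [cite: BDKim2013, Cor. 3.15]
[cite: KuriharaOtsuki2006, p. 564] [cite: Miller2011LMS, Def. 1.1] -/
theorem bsdp_two_of_colemanKatoV5_of_pow_dvd
    (hmod : nonempty_modularParametrizationData)
    (hGZK : rank_eq_analyticRank_of_analyticRank_le_one)
    (h124 : Kato2004.thm12_4) (hX0 : Kato2004_fineSelmerDual_isTorsion)
    (hgood : W.HasGoodReductionAtPrime 2) (ha : W.frobeniusTrace 2 = 0)
    (hL : W.entireLFunction 1 ≠ 0) (hsurj : TwoAdicSurjective W)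
    (h12 : ∀ (κ : ZpExtension ℚ 2) (γ : Field.absoluteGaloisGroup ℚ),
      κ.IsCyclotomic → κ.IsTopGenerator γ →
      ∀ D : SignedSelmerDualData W κ γ 1,
        Module.Finite (IwasawaAlgebra 2) D.X ∧ Module.IsTorsion (IwasawaAlgebra 2) D.X)
    (hKim : ∀ (κ : ZpExtension ℚ 2) (γ : Field.absoluteGaloisGroup ℚ),
      κ.IsCyclotomic → κ.IsTopGenerator γ →
      ∀ (D : SignedSelmerDualData W κ γ 1) [Module.Finite (IwasawaAlgebra 2) D.X],
        Module.IsTorsion (IwasawaAlgebra 2) D.X →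
      ∀ g : IwasawaAlgebra 2, D.charIdeal = Ideal.span {g} → Finite (W.selmerGroupPInfty 2) →
        ∃ u : ℤ_[2]ˣ, ((PowerSeries.constantCoeff g : ℤ_[2]) : ℚ_[2]) =
          ((u : ℤ_[2]) : ℚ_[2]) * ((2 : ℕ) : ℚ_[2]) ^ (padicValNat 2 W.tamagawaProduct) *
            (Nat.card (W.selmerGroupPInfty 2) : ℚ_[2]))
    (hCK : ∀ (κ : ZpExtension ℚ 2) (γ : Field.absoluteGaloisGroup ℚ),
      κ.IsCyclotomic → κ.IsTopGenerator γ → IsCyclotomicVariable 2 γ →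
      ∀ [NeZero (W.conductorNorm ℤ)] (f : CuspForm (Gamma0 (W.conductorNorm ℤ)) 2),
        IsNewformOf W f → ∀ (ϖ : ℚ), (ϖ : ℝ) * W.realPeriodRat = plusPeriod f →
      ∀ (Lplus Lminus : IwasawaAlgebra 2), IsPollackPair f 2 Lplus Lminus →
      ∀ (D : SignedSelmerDualData W κ γ 1) [ContinuousSMul ℤ_[2] (W.tateModule 2)],
        ∃ (I : Kato2004.IwasawaH1Data W 2 κ γ) (Y : W.FineSelmerDualData κ γ)
          (P : Submodule (IwasawaAlgebra 2) (IwasawaAlgebra 2))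
          (loc : I.H →ₗ[IwasawaAlgebra 2] P) (toX : P →ₗ[IwasawaAlgebra 2] D.X)
          (δ : D.X →ₗ[IwasawaAlgebra 2] Y.X) (Z : Submodule (IwasawaAlgebra 2) I.H)
          (G : IwasawaAlgebra 2) (m : ℕ),
          Function.Exact loc toX ∧ Function.Exact toX δ ∧
          G ∈ Submodule.map (P.subtype ∘ₗ loc) Z ∧
          iwasawaToPowerSeries 2 G =
            PowerSeries.C ((2 : ℚ_[2]) ^ m * (ϖ : ℚ_[2])) *
              iwasawaToPowerSeries 2 (kobayashiL 1 Lplus Lminus) ∧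
          (∀ 𝔭 : PrimeSpectrum (IwasawaAlgebra 2), 𝔭.asIdeal.height = 1 →
            PowerSeries.C (2 : ℤ_[2]) ∉ 𝔭.asIdeal →
            Literature.NumberTheory.EllipticCurves.Module.lengthAt (IwasawaAlgebra 2) Y.X 𝔭 ≤
              Literature.NumberTheory.EllipticCurves.Module.lengthAt (IwasawaAlgebra 2) (I.H ⧸ Z) 𝔭) ∧
          (TwoAdicSurjective W → m = 0 ∧
            ∀ 𝔭 : PrimeSpectrum (IwasawaAlgebra 2), 𝔭.asIdeal.height = 1 →
              PowerSeries.C (2 : ℤ_[2]) ∈ 𝔭.asIdeal →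
              Literature.NumberTheory.EllipticCurves.Module.lengthAt (IwasawaAlgebra 2) Y.X 𝔭 ≤
                Literature.NumberTheory.EllipticCurves.Module.lengthAt (IwasawaAlgebra 2) (I.H ⧸ Z) 𝔭))
    {q : ℚ} (hq : shaAn W = (q : ℂ)) {m : ℕ} (hv : padicValRat 2 q ≤ m)
    (hdvd : 2 ^ m ∣ W.shaOrder) : BSDp W 2 ∧ KobayashiMainConjecture W 2 1 :=
  bsdp_two_of_upper_of_pow_dvd W hmod hGZK hgood ha hL h12 hKim
    (signedUpperDivisibility_two_of_colemanKatoV5 h124 hX0 hsurj hCK) hq hv hdvd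

end Door

/-! ## §2 Integer-model bookkeeping for the `a₂ = 0` classes -/

section IntModel

variable (M : WeierstrassCurve ℤ)

/-- **Good supersingular reduction at `2` with `a₂(E) = 0`, read off the integer model**: for a globally
minimal `M ⊗ ℚ`, `2 ∤ Δ(M)` gives good reduction at `2` (Silverman VII.5 Prop. 5.1 (a)) and
`#M̃(𝔽₂) = 3` gives `a₂ = 3 − 3 = 0`, hence `GoodSS`. [cite: SilvermanAEC2009, VII.5 Prop. 5.1(a) and V.2] -/
theorem goodSS_two_baseChange_int_of_card_three [(M.baseChange ℚ).IsGloballyMinimal]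
    (hΔ : ¬ (2 : ℤ) ∣ M.Δ) (hcard : Nat.card (M.map (Int.castRingHom (ZMod 2))).toAffine.Point = 3) :
    (M.baseChange ℚ).HasGoodReductionAtPrime 2 ∧ (M.baseChange ℚ).frobeniusTrace 2 = 0 ∧
      GoodSS (M.baseChange ℚ) 2 := by
  have hgood : (M.baseChange ℚ).HasGoodReductionAtPrime 2 :=
    hasGoodReductionAtPrime_of_not_dvd _ 2 (by
      rw [Instances.minimalDiscriminantInt_baseChange_int]; exact_mod_cast hΔ)
  have ha : (M.baseChange ℚ).frobeniusTrace 2 = 0 := by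
    rw [frobeniusTrace_two_baseChange_int M hcard]; norm_num
  exact ⟨hgood, ha, hgood, by rw [ha]; exact dvd_zero _⟩

/-- **No CM from a non-integral `j`-invariant, integer-model form**: if `Δ(M) ∤ c₄(M)³` then
`j = c₄³/Δ ∉ ℤ`, whereas CM curves over `ℚ` have integral `j`. [cite: SilvermanAEC2009, App. C §11]
[cite: SilvermanATAEC1994, Thm. II.6.1] -/
theorem not_hasCM_baseChange_int_of_not_dvd [(M.baseChange ℚ).IsElliptic] (h : ¬ M.Δ ∣ M.c₄ ^ 3) :
    ¬ (M.baseChange ℚ).HasCM := fun hCM ↦ by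
  obtain ⟨n, hn⟩ := (M.baseChange ℚ).exists_intCast_eq_j_of_hasCM hCM
  rw [j_eq_c₄_pow_div, baseChange_int_c₄, baseChange_int_Δ] at hn
  have hD : (M.Δ : ℚ) ≠ 0 := by
    have := (M.baseChange ℚ).isUnit_Δ.ne_zero
    rwa [baseChange_int_Δ] at this
  have h' : (n : ℚ) * M.Δ = (M.c₄ : ℚ) ^ 3 := by rw [hn]; field_simp
  have h'' : n * M.Δ = M.c₄ ^ 3 := by exact_mod_cast h'
  exact h ⟨n, by rw [← h'']; ring⟩

/-- **No CM from the thirteen rational CM `j`-invariants**: `j(W) ∉ cmJInvariants ⇒ ¬ HasCM` (the tree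
theorem `WeierstrassCurve.hasCM_iff_j_mem_holds`, Silverman App. C §11). For the classes with integral
`j`. [cite: SilvermanAEC2009, App. C §11 Examples 11.3.1–11.3.2] -/
theorem not_hasCM_of_j_eq_of_not_mem (W : WeierstrassCurve ℚ) [W.IsElliptic] {j₀ : ℚ} (hj : W.j = j₀)
    (h : j₀ ∉ cmJInvariants) : ¬ W.HasCM := fun hCM ↦
  h (hj ▸ (W.hasCM_iff_j_mem_holds).1 hCM)

/-- **`TwoAdicSurjective (M ⊗ ℚ)` from integer data and four Dokchitser–Dokchitser certificates**
(`twoAdicSurjective_of_certificates` with `b₂, b₄, b₆, Δ` read off `M` and `j = c₄³/Δ = n/d`).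
[cite: DokchitserDokchitserMathZ2012, Theorem (p. 961)] -/
theorem twoAdicSurjective_baseChange_int_of_certificates [(M.baseChange ℚ).IsElliptic]
    (hDD : DokchitserDokchitser2012_surjective_mod_two_four_eight)
    {B₂ B₄ B₆ D C4 n d : ℤ} (hb₂ : M.b₂ = B₂) (hb₄ : M.b₄ = B₄) (hb₆ : M.b₆ = B₆) (hΔ : M.Δ = D)
    (hc₄ : M.c₄ = C4) (hd : d ≠ 0) (hnd : (C4 : ℚ) ^ 3 / (D : ℚ) = (n : ℚ) / (d : ℚ))
    {ℓ₁ ℓ₂ ℓ₃ ℓ₄ : ℕ} (hℓ₄ : 1 < ℓ₄)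
    (h₁ : ∀ r : ZMod ℓ₁,
      r ^ 3 + (B₂ : ZMod ℓ₁) * r ^ 2 + ((8 * B₄ : ℤ) : ZMod ℓ₁) * r + ((16 * B₆ : ℤ) : ZMod ℓ₁) ≠ 0)
    (h₂ : ∀ r : ZMod ℓ₂, r * r ≠ ((|D| : ℤ) : ZMod ℓ₂))
    (h₃ : ∀ r : ZMod ℓ₃, r * r ≠ ((2 * |D| : ℤ) : ZMod ℓ₃))
    (h₄ : ∀ a b : ZMod ℓ₄, (a ≠ 0 ∨ b ≠ 0) →
      4 * (d : ZMod ℓ₄) * a ^ 4 + 32 * (d : ZMod ℓ₄) * a ^ 3 * b + (n : ZMod ℓ₄) * b ^ 4 ≠ 0) :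
    TwoAdicSurjective (M.baseChange ℚ) := by
  refine twoAdicSurjective_of_certificates _ hDD (B₂ := B₂) (B₄ := B₄) (B₆ := B₆) (D := D) (n := n)
    (d := d) ?_ ?_ ?_ ?_ hd ?_ hℓ₄ h₁ h₂ h₃ h₄
  · simp [WeierstrassCurve.baseChange, WeierstrassCurve.map_b₂, hb₂]
  · simp [WeierstrassCurve.baseChange, WeierstrassCurve.map_b₄, hb₄]
  · simp [WeierstrassCurve.baseChange, WeierstrassCurve.map_b₆, hb₆]
  · rw [baseChange_int_Δ, hΔ]
  · rw [j_eq_c₄_pow_div, baseChange_int_Δ, baseChange_int_c₄, hΔ, hc₄, hnd]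

end IntModel

/-- `v₂(Q) ≤ m` for a natural number `Q ≠ 0` with `2^(m+1) ∤ Q` — the certificate binder `hv` of the
door in decidable form (`#Ш_an = Q ∈ {16, 64, 400, 784}` on the sub-row). [folklore] -/
theorem padicValRat_two_natCast_le {Q m : ℕ} (hQ : Q ≠ 0) (h : ¬ 2 ^ (m + 1) ∣ Q) :
    padicValRat 2 (Q : ℚ) ≤ m := by
  rw [padicValRat.of_nat]
  have : ¬ m + 1 ≤ padicValNat 2 Q := fun hle ↦ h ((padicValNat_dvd_iff_le hQ).mpr hle)
  exact_mod_cast Nat.lt_succ_iff.mp (not_le.mp this)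

/-! ## §3 The one-line target of a class file -/

/-- **`BSD(E, 2) ∧ KobayashiMainConjecture(E, 2, +)` for `E = M ⊗ ℚ` ON THE COLEMAN ROAD v5 — the
class-instance shape of crux `SupersingularRankZeroAtTwo` on the `a₂ = 0`, `2`-adically surjective
classes.** KERNEL inputs (decided per class on literals): `Δ(M) = D` odd, `c₄(M) = C4`, `b₂, b₄, b₆`,
`#M̃(𝔽₂) = 3` (`a₂ = 0`), `C4³/D = n/d`, four Dokchitser–Dokchitser certificates `ℓ₁…ℓ₄`, `2^(m+1) ∤ Q`;
the instances `IsElliptic`, `IsGloballyMinimal` of `W = M ⊗ ℚ` (class file: `Δ ≠ 0`, Silverman's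
criterion). DISPLAYED: PRINT {`hmod`, `hGZK`, `h124`, `hX0`, `hDD`}; READ-AT-2 {`h12`, `hKim`, `hCK`
(v5 package)}; CERT {`L(E,1) ≠ 0`, `#Ш_an = Q`, `2^m ∣ #Ш`}. Closes nothing by itself.
[cite: Kobayashi2003, Thm. 1.2, Thm. 4.1 and §7] [cite: Kato2004Asterisque, Thm. 12.4–12.6]
[cite: BDKim2013, Cor. 3.15] [cite: KuriharaOtsuki2006, p. 564] [cite: DokchitserDokchitserMathZ2012, Theorem]
[cite: SilvermanAEC2009, VII.5 Prop. 5.1(a)] [cite: Miller2011LMS, Def. 1.1] -/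
theorem bsdp_two_baseChange_int_of_colemanKatoV5 (M : WeierstrassCurve ℤ)
    {B₂ B₄ B₆ D C4 n d : ℤ} (hb₂ : M.b₂ = B₂) (hb₄ : M.b₄ = B₄) (hb₆ : M.b₆ = B₆) (hΔ : M.Δ = D)
    (hc₄ : M.c₄ = C4) (h2 : ¬ (2 : ℤ) ∣ D)
    (hcard : Nat.card (M.map (Int.castRingHom (ZMod 2))).toAffine.Point = 3)
    (hd : d ≠ 0) (hnd : (C4 : ℚ) ^ 3 / (D : ℚ) = (n : ℚ) / (d : ℚ))
    {ℓ₁ ℓ₂ ℓ₃ ℓ₄ : ℕ} (hℓ₄ : 1 < ℓ₄)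
    (h₁ : ∀ r : ZMod ℓ₁,
      r ^ 3 + (B₂ : ZMod ℓ₁) * r ^ 2 + ((8 * B₄ : ℤ) : ZMod ℓ₁) * r + ((16 * B₆ : ℤ) : ZMod ℓ₁) ≠ 0)
    (h₂ : ∀ r : ZMod ℓ₂, r * r ≠ ((|D| : ℤ) : ZMod ℓ₂))
    (h₃ : ∀ r : ZMod ℓ₃, r * r ≠ ((2 * |D| : ℤ) : ZMod ℓ₃))
    (h₄ : ∀ a b : ZMod ℓ₄, (a ≠ 0 ∨ b ≠ 0) →
      4 * (d : ZMod ℓ₄) * a ^ 4 + 32 * (d : ZMod ℓ₄) * a ^ 3 * b + (n : ZMod ℓ₄) * b ^ 4 ≠ 0)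
    {Q m : ℕ} (hQ : Q ≠ 0) (hQm : ¬ 2 ^ (m + 1) ∣ Q)
    (hmod : nonempty_modularParametrizationData)
    (hGZK : rank_eq_analyticRank_of_analyticRank_le_one)
    (h124 : Kato2004.thm12_4) (hX0 : Kato2004_fineSelmerDual_isTorsion)
    (hDD : DokchitserDokchitser2012_surjective_mod_two_four_eight) :
    ∀ (W : WeierstrassCurve ℚ) [W.IsElliptic] [W.IsGloballyMinimal], W = M.baseChange ℚ →
    (∀ (κ : ZpExtension ℚ 2) (γ : Field.absoluteGaloisGroup ℚ),
      κ.IsCyclotomic → κ.IsTopGenerator γ →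
      ∀ D : SignedSelmerDualData W κ γ 1,
        Module.Finite (IwasawaAlgebra 2) D.X ∧ Module.IsTorsion (IwasawaAlgebra 2) D.X) →
    (∀ (κ : ZpExtension ℚ 2) (γ : Field.absoluteGaloisGroup ℚ),
      κ.IsCyclotomic → κ.IsTopGenerator γ →
      ∀ (D : SignedSelmerDualData W κ γ 1) [Module.Finite (IwasawaAlgebra 2) D.X],
        Module.IsTorsion (IwasawaAlgebra 2) D.X →
      ∀ g : IwasawaAlgebra 2, D.charIdeal = Ideal.span {g} → Finite (W.selmerGroupPInfty 2) →
        ∃ u : ℤ_[2]ˣ, ((PowerSeries.constantCoeff g : ℤ_[2]) : ℚ_[2]) =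
          ((u : ℤ_[2]) : ℚ_[2]) * ((2 : ℕ) : ℚ_[2]) ^ (padicValNat 2 W.tamagawaProduct) *
            (Nat.card (W.selmerGroupPInfty 2) : ℚ_[2])) →
    (∀ (κ : ZpExtension ℚ 2) (γ : Field.absoluteGaloisGroup ℚ),
      κ.IsCyclotomic → κ.IsTopGenerator γ → IsCyclotomicVariable 2 γ →
      ∀ [NeZero (W.conductorNorm ℤ)] (f : CuspForm (Gamma0 (W.conductorNorm ℤ)) 2),
        IsNewformOf W f → ∀ (ϖ : ℚ), (ϖ : ℝ) * W.realPeriodRat = plusPeriod f →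
      ∀ (Lplus Lminus : IwasawaAlgebra 2), IsPollackPair f 2 Lplus Lminus →
      ∀ (D : SignedSelmerDualData W κ γ 1) [ContinuousSMul ℤ_[2] (W.tateModule 2)],
        ∃ (I : Kato2004.IwasawaH1Data W 2 κ γ) (Y : W.FineSelmerDualData κ γ)
          (P : Submodule (IwasawaAlgebra 2) (IwasawaAlgebra 2))
          (loc : I.H →ₗ[IwasawaAlgebra 2] P) (toX : P →ₗ[IwasawaAlgebra 2] D.X)
          (δ : D.X →ₗ[IwasawaAlgebra 2] Y.X) (Z : Submodule (IwasawaAlgebra 2) I.H)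
          (G : IwasawaAlgebra 2) (m : ℕ),
          Function.Exact loc toX ∧ Function.Exact toX δ ∧
          G ∈ Submodule.map (P.subtype ∘ₗ loc) Z ∧
          iwasawaToPowerSeries 2 G =
            PowerSeries.C ((2 : ℚ_[2]) ^ m * (ϖ : ℚ_[2])) *
              iwasawaToPowerSeries 2 (kobayashiL 1 Lplus Lminus) ∧
          (∀ 𝔭 : PrimeSpectrum (IwasawaAlgebra 2), 𝔭.asIdeal.height = 1 →
            PowerSeries.C (2 : ℤ_[2]) ∉ 𝔭.asIdeal →
            Literature.NumberTheory.EllipticCurves.Module.lengthAt (IwasawaAlgebra 2) Y.X 𝔭 ≤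
              Literature.NumberTheory.EllipticCurves.Module.lengthAt (IwasawaAlgebra 2) (I.H ⧸ Z) 𝔭) ∧
          (TwoAdicSurjective W → m = 0 ∧
            ∀ 𝔭 : PrimeSpectrum (IwasawaAlgebra 2), 𝔭.asIdeal.height = 1 →
              PowerSeries.C (2 : ℤ_[2]) ∈ 𝔭.asIdeal →
              Literature.NumberTheory.EllipticCurves.Module.lengthAt (IwasawaAlgebra 2) Y.X 𝔭 ≤
                Literature.NumberTheory.EllipticCurves.Module.lengthAt (IwasawaAlgebra 2) (I.H ⧸ Z) 𝔭)) →
    W.entireLFunction 1 ≠ 0 → shaAn W = ((Q : ℚ) : ℂ) → 2 ^ m ∣ W.shaOrder →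
      BSDp W 2 ∧ KobayashiMainConjecture W 2 1 := by
  intro W _ _ hW h12 hKim hCK hL hq hdvd
  subst hW
  obtain ⟨hgood, ha, -⟩ := goodSS_two_baseChange_int_of_card_three M (by rwa [hΔ]) hcard
  exact bsdp_two_of_colemanKatoV5_of_pow_dvd _ hmod hGZK h124 hX0 hgood ha hL
    (twoAdicSurjective_baseChange_int_of_certificates M hDD hb₂ hb₄ hb₆ hΔ hc₄ hd hnd hℓ₄ h₁ h₂ h₃ h₄)
    h12 hKim hCK hq (padicValRat_two_natCast_le hQ hQm) hdvd

end SSColemanRoad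
end Summit.BirchSwinnertonDyer.BirchSwinnertonDyer.Theorems

end
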